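import Summits.BirchSwinnertonDyer.Rank1Residual.X1.LayerAlgebra
import Mathlib.LinearAlgebra.Matrix.Determinant.Basic
import HarnessLib

/-!
# The layer-`1` norm of a quadratic atom at `p = 3`: `N_1(T² + bT + c)` in closed form

B2B cell `bsd-rank1-residual`, unit `eisenstein-p1` GEN 18, FILE 18 (X1R0-GAPMAP §27; the census
column `mord₁` on the quadratic atoms `[2, 1, '1/2']` of the seven `M:paper` classes at `p = 3`).
HONEST FRAMING: research route; THEOREMS ONLY (no `def`, no named fact); pure commutative algebra
of `Λ = ℤ_3⟦T⟧`; nothing about any curve; nothing booked.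

FILE 16 (`X1/LayerNormLinear`) computes `N_n(T − r)` for every `p`, `n`; the only other atom shape
in the layer-1 closures of the census at `p = 3` is an irreducible QUADRATIC. Here, by FILE 13's
computable form `layerNorm_eq_det` (the matrix of multiplication by `f` in the basis `1, T, T²`
of `Λ` over `Λ_1 = ℤ_3⟦S⟧`, `S = ω_1 = T³ + 3T² + 3T`, i.e. `T³ = S − 3T − 3T²`,
`T⁴ = −3S + (S + 9)T + 6T²`) and `Matrix.det_fin_three`:

  **`N_1(T² + bT + c) = S² + (b³ − 3b² + 3b − 3bc + 6c)·S + c(c² − 3bc + 3c + 3b² − 9b + 9)`.**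

(Check: `b = −2, c = 1`, `f = (T − 1)²`: `S² − 14S + 49 = (S − 7)² = N_1(T − 1)²`, FILE 16.) For
the census atoms (`v₃(c) = 1`, `v₃(b) ≥ 1`): `v₃` of the `S`-coefficient `≥ 2`, of the constant
`≥ 3`, so `ord_𝔪 N_1 = 2 = deg`.

## Sources
* L. Washington, GTM 83, §13.2. [Washington1997]
-/

noncomputable section

namespace Summit.BirchSwinnertonDyer.Rank1Residual.X1.LayerNormQuadratic

open PowerSeries Literature.NumberTheory.EllipticCurves
  Summit.BirchSwinnertonDyer.Rank1Residual.X1.LayerAlgebra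

/-- `T³ = ω_1 − 3T − 3T²` in `ℤ_3⟦T⟧` (`ω_1 = (1+T)³ − 1`). [folklore] -/
theorem X_pow_three_eq :
    (X : IwasawaAlgebra 3) ^ 3 = ((1 + X) ^ 3 ^ 1 - 1) - 3 * X - 3 * X ^ 2 := by
  ring

/-- **`N_1(T² + bT + c)` at `p = 3`**, by the multiplication table of `f = T² + bT + c` in the
basis `1, T, T²` over `Λ_1` and a `3 × 3` determinant (FILE 13 `layerNorm_eq_det`).
[cite: Washington1997, §13.2] -/
theorem layerNorm_three_one_quadratic (b c : ℤ_[3]) :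
    layerNorm 3 1 (X ^ 2 + C b * X + C c) =
      X ^ 2 + C (b ^ 3 - 3 * b ^ 2 + 3 * b - 3 * b * c + 6 * c) * X +
        C (c * (c ^ 2 - 3 * b * c + 3 * c + 3 * b ^ 2 - 9 * b + 9)) := by
  -- the matrix of multiplication by `f` (row `j` = coordinates of `f·T^j`), entries in `Λ_1 = ℤ_3⟦S⟧`
  let Q : Matrix (Fin 3) (Fin 3) (IwasawaAlgebra 3) :=
    Matrix.of ![![C c, C b, 1],
      ![X, C c - 3, C b - 3],
      ![(C b - 3) * X, X + 9 - 3 * C b, C c - 3 * C b + 6]]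
  have hQ : ∀ j : Fin 3, (X ^ 2 + C b * X + C c) * X ^ (j : ℕ) =
      ∑ i : Fin 3, layerHom 3 1 (Q j i) * X ^ (i : ℕ) := by
    intro j
    fin_cases j <;> simp [Q, Fin.sum_univ_three, layerHom_C, layerHom_X, map_ofNat] <;> ring
  rw [layerNorm_eq_det 3 1 Q hQ, Matrix.det_fin_three]
  simp only [Q, Matrix.of_apply, Matrix.cons_val_zero, Matrix.cons_val_one, Matrix.cons_val,
    map_mul, map_sub, map_add, map_pow, map_ofNat]
  ring

/-- The same for the product of two linear atoms, as a check against FILE 16: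
`N_1((T − r)(T − s)) = (S − ((1+r)³ − 1))(S − ((1+s)³ − 1))`. [folklore] -/
theorem layerNorm_three_one_mul_linear (r s : ℤ_[3]) :
    layerNorm 3 1 ((X - C r) * (X - C s)) =
      (X - C ((1 + r) ^ 3 - 1)) * (X - C ((1 + s) ^ 3 - 1)) := by
  have h : (X - C r) * (X - C s) = X ^ 2 + C (-(r + s)) * X + C (r * s) := by
    simp only [map_neg, map_add, map_mul]
    ring
  rw [h, layerNorm_three_one_quadratic]
  simp only [map_mul, map_sub, map_add, map_pow, map_neg, map_ofNat, map_one]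
  ring

end Summit.BirchSwinnertonDyer.Rank1Residual.X1.LayerNormQuadratic

end
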